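import Summits.Ventures.CertifiedArithmetic.LowPrec.ErrorTables

/-!
# Unit in the last place, sub-ulp representability, and Sterbenz's lemma for minifloat formats

HONEST FRAMING (venture CertifiedArithmetic / cell `pub-lowprec`): certified error envelopes and
provably optimal rounding/accumulation schemes for low-precision formats under stated cost models;
every table by two implementations; no hardware or vendor claims.

Integer-level tools for exactness arguments in a format `φ` (file `MiniFloat.lean`): the ulp
exponent `E - 1` of a datum with exponent code `E` (so that `ulp(x) = 2^(E-1)` quanta), the facts
`2^(E-1) ∣ |x|`, `|x| < 2^(p + E - 1)`, monotonicity of `E - 1` in the magnitude, and the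
representability criterion every error-free transformation rests on: an integer multiple of
`ulp(b)` of magnitude at most `|b|` is a value of the format (`representable_natAbs_of_dvd_le`).
As a first application, STERBENZ'S LEMMA for every format of the venture (subnormals included, no
range hypothesis): values `x, y` with `y/2 ≤ x ≤ 2y` have an exactly representable difference
(`sterbenz`; [BoldoMelquiond2017, Thm 5.1], attributed there to [Sterbenz1974]); hence `fl(x - y) = x - y`
under round-to-nearest-even (`toRat_roundNE_sub_of_sterbenz`). Used by `ErrorFreeAdd.lean`
(representable addition error, Fast2Sum) and `CompensatedSum.lean` (Neumaier summation).
-/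

namespace Literature.ComputerArithmetic.FloatingPoint

namespace MiniFloat

open Format

variable {φ : Format}

/-! ### The ulp exponent `expCode - 1` of a datum

Throughout, the ULP EXPONENT of a datum `x` is `x.expCode - 1` (natural subtraction): the spacing
of the format at `x` is `2^(x.expCode - 1)` quanta — `2^(E-1)` in the normal binade `E ≥ 1`, one
quantum in the subnormal binade (and in binade `1`). No new definition is introduced for it. -/

/-- The magnitude of a datum is a multiple of its ulp. [folklore] -/
theorem pow_ulpExp_dvd_scaledMag (x : MiniFloat φ) : 2 ^ (x.expCode - 1) ∣ x.scaledMag := by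
  unfold scaledMag Format.scaled
  split
  · rename_i h; rw [h]; exact one_dvd _
  · exact dvd_mul_left _ _

/-- The magnitude of a datum is below `2^p` ulps (`p = m + 1`). [folklore] -/
theorem scaledMag_lt_pow_ulpExp (x : MiniFloat φ) :
    x.scaledMag < 2 ^ (φ.manBits + 1 + (x.expCode - 1)) := by
  have hm := x.man_lt
  unfold scaledMag Format.scaled
  split
  · rename_i h
    rw [h]
    calc x.man < 2 ^ φ.manBits := hm
      _ ≤ 2 ^ (φ.manBits + 1 + (0 - 1)) := Nat.pow_le_pow_right (by norm_num) (by omega)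
  · rw [pow_add]
    exact Nat.mul_lt_mul_of_pos_right (by rw [pow_succ]; omega) (by positivity)

/-- A normal datum has magnitude at least `2^m` ulps. [folklore] -/
theorem pow_le_scaledMag_of_expCode_pos (x : MiniFloat φ) (h : 1 ≤ x.expCode) :
    2 ^ (φ.manBits + (x.expCode - 1)) ≤ x.scaledMag := by
  unfold scaledMag Format.scaled
  rw [if_neg (by omega), pow_add]
  exact Nat.mul_le_mul_right _ (Nat.le_add_right _ _)

/-- The ulp exponent is monotone in the magnitude. [folklore] -/
theorem ulpExp_mono {x y : MiniFloat φ} (h : y.scaledMag ≤ x.scaledMag) :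
    y.expCode - 1 ≤ x.expCode - 1 := by
  by_contra hlt
  have hlt : x.expCode - 1 < y.expCode - 1 := not_le.mp hlt
  have hy : 1 ≤ y.expCode := by omega
  have h1 := pow_le_scaledMag_of_expCode_pos y hy
  have h2 := scaledMag_lt_pow_ulpExp x
  have h3 : 2 ^ (φ.manBits + 1 + (x.expCode - 1)) ≤ 2 ^ (φ.manBits + (y.expCode - 1)) :=
    Nat.pow_le_pow_right (by norm_num) (by omega)
  omega

/-- Every ulp divides the largest magnitude `maxScaled`. [folklore] -/
theorem pow_ulpExp_dvd_maxScaled (x : MiniFloat φ) : 2 ^ (x.expCode - 1) ∣ φ.maxScaled := by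
  by_cases h : x.expCode ≤ 1
  · rw [show x.expCode - 1 = 0 by omega, pow_zero]; exact one_dvd _
  · have hE := x.expCode_le
    unfold Format.maxScaled Format.scaled
    rw [if_neg (by omega)]
    exact Dvd.dvd.mul_left (Nat.pow_dvd_pow 2 (by omega)) _

/-! ### Representability of sub-ulp multiples -/

/-- A multiple of `2^g` of size at most `2^(p+g)` and within range is representable (if it equals
`2^(p+g)` it is `2^m · 2^(g+1)`). [folklore] -/
theorem representable_of_pow_dvd {g n : ℕ} (hd : 2 ^ g ∣ n) (hle : n ≤ 2 ^ (φ.manBits + 1 + g))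
    (hmax : n ≤ φ.maxScaled) : φ.Representable n := by
  obtain ⟨c, rfl⟩ := hd
  rcases Nat.lt_or_ge c (2 ^ (φ.manBits + 1)) with hc | hc
  · rw [mul_comm] at hmax ⊢; exact representable_mul_pow hc hmax
  · have heq : 2 ^ g * c = 2 ^ φ.manBits * 2 ^ (g + 1) := by
      apply le_antisymm
      · calc 2 ^ g * c ≤ 2 ^ (φ.manBits + 1 + g) := hle
          _ = 2 ^ φ.manBits * 2 ^ (g + 1) := by ring
      · calc 2 ^ φ.manBits * 2 ^ (g + 1) = 2 ^ g * 2 ^ (φ.manBits + 1) := by ring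
          _ ≤ 2 ^ g * c := Nat.mul_le_mul_left _ hc
    rw [heq] at hmax ⊢
    exact representable_mul_pow (by rw [pow_succ]; have := Nat.two_pow_pos φ.manBits; omega) hmax

/-- THE EFT CRITERION: an integer multiple of `ulp(b)` of magnitude at most `|b|` is (the signed
magnitude of) a value of the format (the format-level form of Flocq's `generic_format_plus`
argument). [cite: BoldoMelquiond2017, Lemma 5.2] -/
theorem representable_natAbs_of_dvd_le (b : MiniFloat φ) {T : ℤ}
    (hd : ((2 ^ (b.expCode - 1) : ℕ) : ℤ) ∣ T) (hle : T.natAbs ≤ b.scaledMag) :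
    φ.Representable T.natAbs :=
  representable_of_pow_dvd (Int.natCast_dvd.mp hd)
    (le_trans hle (scaledMag_lt_pow_ulpExp b).le) (le_trans hle b.scaledMag_le_maxScaled)

/-! ### Integer bridges: signed magnitudes in quanta -/

/-- `toRat x = toInt x · quantum`. [folklore] -/
theorem toRat_eq_toInt_mul (x : MiniFloat φ) : x.toRat = (x.toInt : ℚ) * φ.quantum := rfl

/-- The signed magnitude is determined by the value. [folklore] -/
theorem toInt_eq_of_toRat_eq {x : MiniFloat φ} {T : ℤ} (h : x.toRat = (T : ℚ) * φ.quantum) :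
    x.toInt = T := by
  unfold toRat at h
  exact_mod_cast mul_right_cancel₀ (ne_of_gt φ.quantum_pos) h

/-- A representable signed magnitude `T` quanta is the value of some datum. [folklore] -/
theorem exists_toRat_eq_intCast_mul (T : ℤ) (h : φ.Representable T.natAbs) :
    ∃ y : MiniFloat φ, y.toRat = (T : ℚ) * φ.quantum := by
  obtain ⟨hle, -⟩ := representable_iff.mp h
  refine ⟨ofScaled φ (decide (T < 0)) _ hle, ?_⟩
  rw [toRat_ofScaled hle h]
  have hcast : ((T.natAbs : ℕ) : ℚ) = |(T : ℚ)| := by rw [Nat.cast_natAbs, Int.cast_abs]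
  by_cases hT0 : T < 0
  · have hT0' : (T : ℚ) < 0 := by exact_mod_cast hT0
    rw [if_pos (by simpa using hT0), hcast, abs_of_neg hT0']; ring
  · have hT0' : (0 : ℚ) ≤ T := by exact_mod_cast not_lt.mp hT0
    rw [if_neg (by simpa using hT0), hcast, abs_of_nonneg hT0']

/-- A value of the format has a representable magnitude (restated on `toInt`). [folklore] -/
theorem representable_natAbs_toInt (x : MiniFloat φ) : φ.Representable x.toInt.natAbs := by
  rw [natAbs_toInt]; exact x.representable_scaledMag

/-- Order of values is order of signed magnitudes. [folklore] -/
theorem toRat_le_toRat_iff (x y : MiniFloat φ) : x.toRat ≤ y.toRat ↔ x.toInt ≤ y.toInt := by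
  have hq := φ.quantum_pos
  unfold toRat
  constructor
  · intro h; exact_mod_cast le_of_mul_le_mul_right h hq
  · intro h; exact mul_le_mul_of_nonneg_right (by exact_mod_cast h) hq.le

/-- The ulp of a datum divides the signed magnitude of every datum at least as large. [folklore] -/
theorem pow_ulpExp_dvd_toInt {x y : MiniFloat φ} (h : y.scaledMag ≤ x.scaledMag) :
    ((2 ^ (y.expCode - 1) : ℕ) : ℤ) ∣ x.toInt := by
  apply Int.natCast_dvd.mpr
  rw [natAbs_toInt]
  exact dvd_trans (Nat.pow_dvd_pow 2 (ulpExp_mono h)) (pow_ulpExp_dvd_scaledMag x)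

/-! ### Sterbenz's lemma -/

/-- STERBENZ'S LEMMA for every minifloat format (gradual underflow included, no range hypothesis):
if `x, y` are values of `φ` with `y/2 ≤ x ≤ 2·y` then `x - y` is a value of `φ`.
[cite: BoldoMelquiond2017, Thm 5.1 (attributed to Sterbenz1974)] -/
theorem sterbenz (x y : MiniFloat φ) (h1 : y.toRat / 2 ≤ x.toRat) (h2 : x.toRat ≤ 2 * y.toRat) :
    ∃ d : MiniFloat φ, d.toRat = x.toRat - y.toRat := by
  have hq := φ.quantum_pos
  -- in quanta: Y ≤ 2X and X ≤ 2Y (hence both nonnegative)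
  have h1' : y.toInt ≤ 2 * x.toInt := by
    have : (y.toInt : ℚ) * φ.quantum ≤ 2 * ((x.toInt : ℚ) * φ.quantum) := by
      unfold toRat at h1; linarith
    have : (y.toInt : ℚ) ≤ 2 * x.toInt := by nlinarith
    exact_mod_cast this
  have h2' : x.toInt ≤ 2 * y.toInt := by
    have : (x.toInt : ℚ) * φ.quantum ≤ 2 * ((y.toInt : ℚ) * φ.quantum) := by
      unfold toRat at h2; linarith
    have : (x.toInt : ℚ) ≤ 2 * y.toInt := by nlinarith
    exact_mod_cast this
  have hX := natAbs_toInt x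
  have hY := natAbs_toInt y
  suffices hrep : φ.Representable (x.toInt - y.toInt).natAbs by
    obtain ⟨d, hd⟩ := exists_toRat_eq_intCast_mul _ hrep
    exact ⟨d, by rw [hd, toRat_eq_toInt_mul, toRat_eq_toInt_mul]; push_cast; ring⟩
  rcases le_or_gt y.toInt x.toInt with hyx | hxy
  · -- 0 ≤ X - Y ≤ Y: a multiple of ulp(y) of magnitude ≤ |y|
    have hle : y.scaledMag ≤ x.scaledMag := by omega
    have hgx : ((2 ^ (y.expCode - 1) : ℕ) : ℤ) ∣ x.toInt := pow_ulpExp_dvd_toInt hle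
    have hgy : ((2 ^ (y.expCode - 1) : ℕ) : ℤ) ∣ y.toInt := pow_ulpExp_dvd_toInt le_rfl
    exact representable_natAbs_of_dvd_le y (dvd_sub hgx hgy) (by omega)
  · -- 0 < Y - X ≤ X: a multiple of ulp(x) of magnitude ≤ |x|
    have hle : x.scaledMag ≤ y.scaledMag := by omega
    have hgy : ((2 ^ (x.expCode - 1) : ℕ) : ℤ) ∣ y.toInt := pow_ulpExp_dvd_toInt hle
    have hgx : ((2 ^ (x.expCode - 1) : ℕ) : ℤ) ∣ x.toInt := pow_ulpExp_dvd_toInt le_rfl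
    exact representable_natAbs_of_dvd_le x (dvd_sub hgx hgy) (by omega)

/-- Sterbenz under round-to-nearest-even: `fl(x - y) = x - y` whenever `y/2 ≤ x ≤ 2y`.
[cite: BoldoMelquiond2017, Thm 5.1] -/
theorem toRat_roundNE_sub_of_sterbenz (x y : MiniFloat φ) (h1 : y.toRat / 2 ≤ x.toRat)
    (h2 : x.toRat ≤ 2 * y.toRat) : (roundNE φ (x.toRat - y.toRat)).toRat = x.toRat - y.toRat :=
  toRat_roundNE_of_exists (sterbenz x y h1 h2)

/-- Kernel illustration (`E2M1`, values `0, ½, 1, 3/2, 2, 3, 4, 6`): `3 - 3/2 = 3/2` and `6 - 4 = 2`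
are exact (Sterbenz pairs), while `4 - 3/2 = 5/2 ∉ F` (ratio `8/3 > 2`) rounds to `2`.
[folklore] -/
theorem sterbenz_E2M1_examples :
    (roundNE Format.E2M1 (3 - 3 / 2)).toRat = 3 / 2 ∧ (roundNE Format.E2M1 (6 - 4)).toRat = 2 ∧
    (roundNE Format.E2M1 (4 - 3 / 2)).toRat = 2 := by
  decide +kernel

end MiniFloat

end Literature.ComputerArithmetic.FloatingPoint
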